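import Literature.Probability.Percolation.CerfTwoArms
import Mathlib.Order.LiminfLimsup
import Mathlib.MeasureTheory.Measure.Real
import HarnessLib

/-!
# The critical dichotomy for site percolation on `ℤ^d` (Cerf 2026, Thm. 1.2): `θ(p_c) = 0`, or the finite-cluster
# tail at `p_c` is not stretched-exponential

Topic `Literature/Probability/Percolation`.  One named fact (a PROVED theorem of the cited preprint) and the small
notion it is stated with, for Bernoulli SITE percolation on `ℤ^d` (`sitePercolation (Site d) p`, clusters
`siteCluster (zdGraph d) ω x`, `siteTheta`, `siteCriticalProbI d` — all existing tree vocabulary).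

* `siteFiniteClusterTail d p n = P_p(n ≤ |C(0)| < +∞)` — the probability that the open site cluster of the origin is
  finite and has at least `n` vertices (Cerf 2026, (1.1)–(1.5): "the tail of the finite cluster size distribution").
  API: `siteFiniteClusterTail_nonneg`, `siteFiniteClusterTail_le_one`, `siteFiniteClusterTail_anti` (non-increasing
  in `n`).
* `siteTailLogLogRate d p = liminf_{n → ∞} (1 / ln n) · ln ln (1 / P_p(n ≤ |C(0)| < +∞))` — the functional of
  (1.1)/(1.4)/(1.5) (it equals `1` for `p < p_c` by (1.4) and `1 − 1/d` for `p > p_c` by Kesten–Zhang (1.5); the value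
  `0` means "no stretched-exponential decay").  Rendered with Mathlib's `Filter.liminf` over `ℝ` along `atTop : Filter ℕ`.
  Documented junk: `Real.log 0 = 0` and `1 / 0 = 0`, so the `n`-th term is `0` whenever `P_p(n ≤ |C(0)| < ∞) ∈ {0, 1}`
  or `n ≤ 1`; and `Filter.liminf` of a real sequence that is not eventually bounded below / frequently bounded above is
  the junk value `sSup ∅ = 0` / `sSup univ = 0`.  In the only case where the fact below uses the functional non-trivially
  (`θ(p_c) > 0`, so `0 < p_c < 1` and `P_{p_c}(n ≤ |C(0)| < ∞) ∈ (0, 1)` tends to `0`), the terms are eventually in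
  `[0, 1 + o(1)]` (a finite cluster of size `n` has probability `≥ (p_c (1 - p_c)^{2d})^n`), so `Filter.liminf` is the
  classical lower limit there.
* `Cerf2026_criticalDichotomy` — NAMED FACT, **Cerf 2026, Thm. 1.2** (verbatim): "Let `d ≥ 3` and let `p_c` be the
  critical point for the Bernoulli site percolation in `ℤ^d`. Denoting by `C(0)` the cluster of the origin, we have
  either `θ(p_c, ℤ^d) = 0` or `liminf_{n→∞} (1/ln n) ln ln (1 / P_{p_c}(n ≤ |C(0)| < +∞)) = 0`. (1.1)"
  ("for the Bernoulli percolation model in `ℤ^d` with `d ≥ 3`, at the critical point `p_c`, either there is no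
  infinite cluster or the tail of the finite cluster distribution is not a stretched exponential").  Cerf's
  `θ(p, ℤ^d) = P_p(0 ↔ ∞)` is the tree's `siteTheta (zdGraph d) 0 p`, and his `p_c = sup {p ∈ [0,1] : θ(p, ℤ^d) = 0}`
  is the tree's `siteCriticalProb (zdGraph d) 0 = inf ({p : θ > 0} ∪ {1})` (`siteCriticalProbI d` as a point of
  `[0,1]`): the two agree because `θ` is non-decreasing in `p`.  The first member of the dichotomy is, verbatim, the
  summit-side node `SitePercolationContinuity d` (`Summits/CriticalPhenomena/PercolationContinuityZ3/Theorems/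
  Transplant/StatementSite.lean`), which Literature cannot import; it is spelled out here.

Deliberately NOT here: Thm. 1.3 (`θ(p) > 0` and rate `> 0` ⇒ `p > p_c`, which implies Thm. 1.2), the implication
(1.6) and statement 1.4 of the paper (not proved there, hence not Literature material), the limits (1.3)–(1.5)
(Menshikov / Aizenman–Barsky, Kesten–Zhang, Grimmett–Marstrand) — available on request as separate facts.

Reference: R. Cerf, *`θ(p_c, ℤ^d) = 0`?*, arXiv:2608.23661v1 (22 Aug 2026), §1, Thm. 1.2 and display (1.1), p. 2
[Cerf2026] (unrefereed preprint; the theorem is proved there, §§2–9).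
-/

noncomputable section

open MeasureTheory Filter Literature.Probability.LatticeModels

namespace Literature.Probability.Percolation

/-! ### The finite-cluster tail of site percolation on `ℤ^d` -/

/-- **`P_p(n ≤ |C(0)| < +∞)`** for Bernoulli site percolation on `ℤ^d`: the probability that the open site cluster of
the origin is finite and contains at least `n` vertices. [cite: Cerf2026, §1 (display (1.1); "the tail of the finite cluster size distribution")] -/
def siteFiniteClusterTail (d : ℕ) (p : unitInterval) (n : ℕ) : ℝ :=
  (sitePercolation (Site d) p).real
    {ω | (siteCluster (zdGraph d) ω 0).Finite ∧ n ≤ (siteCluster (zdGraph d) ω 0).ncard}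

/-- `P_p(n ≤ |C(0)| < ∞) ≥ 0`. [cite: Cerf2026, §1 (display (1.1))] -/
theorem siteFiniteClusterTail_nonneg (d : ℕ) (p : unitInterval) (n : ℕ) : 0 ≤ siteFiniteClusterTail d p n :=
  measureReal_nonneg

/-- `P_p(n ≤ |C(0)| < ∞) ≤ 1`. [cite: Cerf2026, §1 (display (1.1))] -/
theorem siteFiniteClusterTail_le_one (d : ℕ) (p : unitInterval) (n : ℕ) : siteFiniteClusterTail d p n ≤ 1 :=
  measureReal_le_one

/-- `n ↦ P_p(n ≤ |C(0)| < ∞)` is non-increasing. [cite: Cerf2026, §1 (display (1.2))] -/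
theorem siteFiniteClusterTail_anti (d : ℕ) (p : unitInterval) : Antitone (siteFiniteClusterTail d p) := by
  intro m n hmn
  refine measureReal_mono ?_
  rintro ω ⟨hfin, hn⟩
  exact ⟨hfin, hmn.trans hn⟩

/-- **Cerf's tail functional** `liminf_{n→∞} (1/ln n) ln ln (1 / P_p(n ≤ |C(0)| < +∞))` (the left-hand side of
(1.1), (1.4), (1.5)), via Mathlib's `Filter.liminf` along `atTop : Filter ℕ`.  Junk values (`log 0 = 0`, `1/0 = 0`,
unbounded sequences) are documented in the module docstring; they do not arise in the case `θ(p) > 0`, `0 < p < 1`.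
[cite: Cerf2026, §1 (displays (1.1), (1.4), (1.5))] -/
def siteTailLogLogRate (d : ℕ) (p : unitInterval) : ℝ :=
  Filter.liminf (fun n : ℕ => Real.log (Real.log (1 / siteFiniteClusterTail d p n)) / Real.log (n : ℝ)) atTop

/-! ### Named fact: Cerf 2026, Theorem 1.2 -/

/-- NAMED FACT — **Cerf 2026, Thm. 1.2** (verbatim): "Let `d ≥ 3` and let `p_c` be the critical point for the
Bernoulli site percolation in `ℤ^d`. Denoting by `C(0)` the cluster of the origin, we have either `θ(p_c, ℤ^d) = 0`
or `liminf_{n→∞} (1/ln n) ln ln (1 / P_{p_c}(n ≤ |C(0)| < +∞)) = 0`."  Vendored for SITE percolation on the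
nearest-neighbour lattice `zdGraph d` with the tree's `siteTheta` (`= θ(p, ℤ^d) = P_p(0 ↔ ∞)`) and
`siteCriticalProbI d` (`= p_c`, equal to Cerf's `sup {p : θ(p, ℤ^d) = 0}` by monotonicity of `θ`); the first member
is verbatim the summit-side node `SitePercolationContinuity d`.  A theorem of the cited preprint (proof §§2–9, via
Thm. 1.3).  Users take `(h : Cerf2026_criticalDichotomy)`. [cite: Cerf2026, Thm. 1.2 (display (1.1), p. 2)] -/
def Cerf2026_criticalDichotomy : Prop :=
  ∀ d : ℕ, 3 ≤ d →
    siteTheta (zdGraph d) (0 : Site d) (siteCriticalProbI d) = 0 ∨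
      siteTailLogLogRate d (siteCriticalProbI d) = 0

end Literature.Probability.Percolation

end
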